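import Summits.CriticalPhenomena.CardyFormulaZ2.Theorems.CardyBoundaryCoulombGasHalfPlaneMarkDensityLawBoxExhaustionPart3

/-!
# Box exhaustion at a general mesh: the lattice sandwich for continuum row arcs

Support file (line `Sketch`, registered stubs `stub_meshLower`, `stub_meshUpper`, crux
`Summit.CriticalPhenomena.CardyFormulaZ2.Theses.CardyBoundaryCoulombGas.HalfPlaneMarkDensityLaw`,
stmt-CriticalPhenomena-5661; input of the subsequential rigidity programme of the line).

This is the GENERAL-MESH version of part 3 of the box exhaustion
(`…HalfPlaneMarkDensityLawBoxExhaustionPart3`). For a conformal rectangle `R` whose carrier is the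
box `Ω = (-K, K) × (0, H)` and whose arcs `0`, `2` are the bottom segments `[S₀, S₁] × {0}`,
`[S₂, S₃] × {0}`, at an ARBITRARY mesh `δ > 0`, with the "continuum" row arcs of `ℤ × ℕ`
`{v : v₁ = 0, S₀ ≤ δ v₀ ≤ S₁}`, `{v : v₁ = 0, S₂ ≤ δ v₀ ≤ S₃}`:

* LOWER (`stub_meshLower`, `MeshSandwich.bondDomainCrossingProb_le`):
  `bondDomainCrossingProb R δ ≤ P_{1/2}[{S₀ ≤ δ v₀ ≤ S₁} ↔ {S₂ ≤ δ v₀ ≤ S₃} in ℤ × ℕ]`;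
* UPPER (`stub_meshUpper`, `MeshSandwich.measureReal_openCrossing_halfPlane_le`):
  `P_{1/2}[{S₀ ≤ δ v₀ ≤ S₁} ↔ {S₂ ≤ δ v₀ ≤ S₃} in ℤ × ℕ] ≤ bondDomainCrossingProb R δ + P_{1/2}[Λ_r ↔ Λ_Nᶜ]`
  whenever the first arc lies in `Λ_r`, `r ≤ N` and `δ (N + 1) < min K H`.

By part 2 (`discreteArc_boxDomain_subset`, `mem_discreteArc_boxDomain`) the discrete arc of
`[S₀, S₁] × {0}` at mesh `δ` is EXACTLY the translate `{v : v₁ = 0, S₀ ≤ δ v₀ ≤ S₁} + e₁` under the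
stated side conditions, so (unlike part 3, where the floors `⌊an⌋` had to be absorbed by enlarged
arcs) no enlargement is needed; the rest is part 3 verbatim: a crossing of `Ω_δ` is an open path of
the lattice box `{0 ≤ v₁, |δ v₀| < K, δ (v₁ + 1) < H} + e₁` (parts 1–2), `P_{1/2}` is translation
invariant (`real_openCrossing_shift`), and a half-plane crossing not staying in the lattice box exits
it (`exists_exit_of_not_openConnIn`) before leaving `Λ_N`.
-/

noncomputable section

namespace Summit.CriticalPhenomena.CardyFormulaZ2.Cruxes.HalfPlaneMarkDensityLaw.SketchLine

open Set Metric Complex MeasureTheory Filter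
open Literature.Probability.LatticeModels Literature.Probability.Percolation
open Literature.Probability.RandomPlanarGeometry (ConformalRectangle)
open Summit.CriticalPhenomena.CardyFormulaZ2.Theorems.HalfPlaneMarkDensityLaw.Negative
open scoped Topology

variable {K H δ : ℝ}

namespace MeshSandwich

open BoxExhaustion

/-! ## The translated row arcs and half-plane -/

/-- Membership in the translate by `e₁` of a continuum row arc `{v : v₁ = 0, S₀ ≤ δ v₀ ≤ S₁}`: the
row `{v : v₁ = 1, S₀ ≤ δ v₀ ≤ S₁}`. [folklore] -/
theorem mem_image_rowArc_iff {S₀ S₁ : ℝ} {x : Site 2} :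
    x ∈ (· + (![0, 1] : Site 2)) '' {v : Site 2 | v 1 = 0 ∧ S₀ ≤ δ * v 0 ∧ δ * v 0 ≤ S₁} ↔
      x 1 = 1 ∧ S₀ ≤ δ * x 0 ∧ δ * x 0 ≤ S₁ := by
  rw [image_add_eq]
  simp only [mem_setOf_eq, Pi.sub_apply, Matrix.cons_val_one, Matrix.cons_val_zero, sub_zero,
    sub_eq_zero]

/-- Membership in the translate by `e₁` of the lattice upper half-plane `ℤ × ℕ`. [folklore] -/
theorem mem_image_halfPlane_iff {x : Site 2} :
    x ∈ (· + (![0, 1] : Site 2)) '' halfPlane ↔ 1 ≤ x 1 := by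
  rw [image_add_eq]
  simp only [halfPlane, mem_setOf_eq, Pi.sub_apply, Matrix.cons_val_one, Matrix.cons_val_zero,
    sub_nonneg]

/-! ## LOWER: a crossing of `Ω_δ` is a crossing of the shifted lattice half-plane -/

/-- A crossing of the discretised box between the discrete arcs of `[S₀, S₁] × {0}` and
`[S₂, S₃] × {0}` at mesh `δ` is an open crossing of `ℤ × ℕ + e₁` between the translated continuum
row arcs `{v : v₁ = 0, S₀ ≤ δ v₀ ≤ S₁} + e₁`, `{v : v₁ = 0, S₂ ≤ δ v₀ ≤ S₃} + e₁`. [folklore] -/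
theorem discreteCrossing_subset (hK : 0 < K) (hδ : 0 < δ) (hH2 : 2 * δ < H) {S₀ S₁ S₂ S₃ : ℝ}
    (h01 : S₀ ≤ S₁) (h23 : S₂ ≤ S₃) (h0 : -K < S₀ - δ) (h1 : S₁ + δ < K) (h2 : -K < S₂ - δ)
    (h3 : S₃ + δ < K) :
    discreteCrossing (Ioo (-K) K ×ℂ Ioo 0 H) δ {z : ℂ | z.im = 0 ∧ z.re ∈ Icc S₀ S₁}
        {z : ℂ | z.im = 0 ∧ z.re ∈ Icc S₂ S₃} ⊆
      openCrossing ((· + (![0, 1] : Site 2)) '' halfPlane)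
        ((· + (![0, 1] : Site 2)) '' {v : Site 2 | v 1 = 0 ∧ S₀ ≤ δ * v 0 ∧ δ * v 0 ≤ S₁})
        ((· + (![0, 1] : Site 2)) '' {v : Site 2 | v 1 = 0 ∧ S₂ ≤ δ * v 0 ∧ δ * v 0 ≤ S₃}) := by
  rintro ω ⟨x, hx, z, hz, hr⟩
  have hx' := discreteArc_boxDomain_subset hδ hK hH2 h01 h0 h1 hx
  have hz' := discreteArc_boxDomain_subset hδ hK hH2 h23 h2 h3 hz
  have hxD : x ∈ meshDomain (Ioo (-K) K ×ℂ Ioo 0 H) δ :=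
    meshBoundary_subset_meshDomain _ _ (discreteArc_subset_meshBoundary _ _ _ hx)
  have hconn := openConnIn_meshDomain_of_reachable hxD hr
  rw [meshDomain_boxDomain hδ] at hconn
  refine ⟨x, mem_image_rowArc_iff.2 hx', z, mem_image_rowArc_iff.2 hz',
    openConnIn_mono ?_ _ _ hconn⟩
  intro v hv
  exact mem_image_halfPlane_iff.2 (one_le_of_mul_pos hδ (mem_meshVertices_boxDomain.1 hv).2.1)

/-- **LOWER bound, general mesh.** For a conformal rectangle whose carrier is the box and whose
arcs `0`, `2` are `[S₀, S₁] × {0}`, `[S₂, S₃] × {0}`: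
`bondDomainCrossingProb R δ ≤ P_{1/2}[{S₀ ≤ δ v₀ ≤ S₁} ↔ {S₂ ≤ δ v₀ ≤ S₃} in ℤ × ℕ]`
(translation invariance of `P_{1/2}`). [folklore] -/
theorem bondDomainCrossingProb_le (hK : 0 < K) (hδ : 0 < δ) (hH2 : 2 * δ < H) {S₀ S₁ S₂ S₃ : ℝ}
    (h01 : S₀ ≤ S₁) (h23 : S₂ ≤ S₃) (h0 : -K < S₀ - δ) (h1 : S₁ + δ < K) (h2 : -K < S₂ - δ)
    (h3 : S₃ + δ < K) (R : ConformalRectangle) (hRc : R.carrier = Ioo (-K) K ×ℂ Ioo 0 H)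
    (hR0 : R.arc 0 = {z : ℂ | z.im = 0 ∧ z.re ∈ Icc S₀ S₁})
    (hR2 : R.arc 2 = {z : ℂ | z.im = 0 ∧ z.re ∈ Icc S₂ S₃}) :
    bondDomainCrossingProb R δ ≤
      μ.real (openCrossing halfPlane {v : Site 2 | v 1 = 0 ∧ S₀ ≤ δ * v 0 ∧ δ * v 0 ≤ S₁}
        {v : Site 2 | v 1 = 0 ∧ S₂ ≤ δ * v 0 ∧ δ * v 0 ≤ S₃}) := by
  rw [bondDomainCrossingProb_eq_measureReal, hRc, hR0, hR2]
  calc _ ≤ μ.real (openCrossing ((· + (![0, 1] : Site 2)) '' halfPlane)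
        ((· + (![0, 1] : Site 2)) '' {v : Site 2 | v 1 = 0 ∧ S₀ ≤ δ * v 0 ∧ δ * v 0 ≤ S₁})
        ((· + (![0, 1] : Site 2)) '' {v : Site 2 | v 1 = 0 ∧ S₂ ≤ δ * v 0 ∧ δ * v 0 ≤ S₃})) :=
        measureReal_mono (discreteCrossing_subset hK hδ hH2 h01 h23 h0 h1 h2 h3)
          (measure_ne_top _ _)
    _ = _ := real_openCrossing_shift half _ _ _ _

/-! ## UPPER: a half-plane crossing stays in the lattice box or escapes it -/

/-- A crossing of the shifted lattice box `{v | 0 ≤ v₁, |δ v₀| < K, δ (v₁ + 1) < H} + e₁` between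
the translated continuum row arcs by a lattice configuration is a crossing of `Ω_δ` between the
discrete arcs of `[S₀, S₁] × {0}` and `[S₂, S₃] × {0}` (part 2: the translated row arcs lie in the
discrete arcs once `[Sᵢ, Sᵢ₊₁] ⊆ [-K + δ, K - δ]` and `2δ ≤ H`). [folklore] -/
theorem shift_openCrossing_subset (hK : 0 < K) (hδ : 0 < δ) (hH2 : 2 * δ ≤ H) {S₀ S₁ S₂ S₃ : ℝ}
    (h0 : -K + δ ≤ S₀) (h1 : S₁ + δ ≤ K) (h2 : -K + δ ≤ S₂) (h3 : S₃ + δ ≤ K)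
    {ω : BondConfig (Site 2)} (hωE : ω ⊆ (zdGraph 2).edgeSet)
    (hω : ω ∈ openCrossing
      ((· + (![0, 1] : Site 2)) ''
        {v : Site 2 | 0 ≤ v 1 ∧ -K < δ * v 0 ∧ δ * v 0 < K ∧ δ * (v 1 + 1) < H})
      ((· + (![0, 1] : Site 2)) '' {v : Site 2 | v 1 = 0 ∧ S₀ ≤ δ * v 0 ∧ δ * v 0 ≤ S₁})
      ((· + (![0, 1] : Site 2)) '' {v : Site 2 | v 1 = 0 ∧ S₂ ≤ δ * v 0 ∧ δ * v 0 ≤ S₃})) :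
    ω ∈ discreteCrossing (Ioo (-K) K ×ℂ Ioo 0 H) δ
      {z : ℂ | z.im = 0 ∧ z.re ∈ Icc S₀ S₁} {z : ℂ | z.im = 0 ∧ z.re ∈ Icc S₂ S₃} := by
  obtain ⟨x, hx, z, hz, hconn⟩ := hω
  rw [mem_image_rowArc_iff] at hx hz
  refine ⟨x, mem_discreteArc_boxDomain hδ hK hH2 h0 h1 hx.1 hx.2.1 hx.2.2, z,
    mem_discreteArc_boxDomain hδ hK hH2 h2 h3 hz.1 hz.2.1 hz.2.2,
    reachable_of_openConnIn_boxDomain hδ hωE (openConnIn_mono ?_ _ _ hconn)⟩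
  intro v hv
  rw [image_add_eq] at hv
  simp only [mem_setOf_eq, Pi.sub_apply, Matrix.cons_val_one, Matrix.cons_val_zero, sub_zero,
    sub_nonneg, Int.cast_sub, Int.cast_one, sub_add_cancel] at hv
  rw [mem_meshVertices_boxDomain]
  have : (1 : ℝ) ≤ v 1 := by exact_mod_cast hv.1
  exact ⟨⟨hv.2.1, hv.2.2.1⟩, by positivity, hv.2.2.2⟩

/-- A half-plane crossing from the continuum row arc `{v : v₁ = 0, S₀ ≤ δ v₀ ≤ S₁} ⊆ Λ_r` that is
not a crossing of the lattice box `Λ = {0 ≤ v₁, |δ v₀| < K, δ (v₁ + 1) < H}` escapes: some site of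
`Λ_r` is joined to a site outside `Λ_N` (when `r ≤ N` and `δ (N + 1) < min K H`, so that
`Λ_N ∩ (ℤ × ℕ) ⊆ Λ`). [folklore] -/
theorem diff_subset_escape (hδ : 0 < δ) {S₀ S₁ : ℝ} {C : Set (Site 2)} {r N : ℕ}
    (hr : ∀ v : Site 2, v 1 = 0 → S₀ ≤ δ * v 0 → δ * v 0 ≤ S₁ → |v 0| ≤ r) (hrN : r ≤ N)
    (hN : δ * (N + 1) < min K H) :
    openCrossing halfPlane {v : Site 2 | v 1 = 0 ∧ S₀ ≤ δ * v 0 ∧ δ * v 0 ≤ S₁} C \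
        openCrossing {v : Site 2 | 0 ≤ v 1 ∧ -K < δ * v 0 ∧ δ * v 0 < K ∧ δ * (v 1 + 1) < H}
          {v : Site 2 | v 1 = 0 ∧ S₀ ≤ δ * v 0 ∧ δ * v 0 ≤ S₁} C ⊆
      {ω | ∃ x ∈ box 2 r, ∃ y ∉ box 2 N, ω ∈ openConnIn univ x y} := by
  rintro ω ⟨⟨x, hxA, z, hzC, hconn⟩, hF⟩
  set B : Set (Site 2) :=
    {v : Site 2 | 0 ≤ v 1 ∧ -K < δ * v 0 ∧ δ * v 0 < K ∧ δ * (v 1 + 1) < H}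
  have hNK : δ * (N + 1) < K := lt_of_lt_of_le hN (min_le_left _ _)
  have hNH : δ * (N + 1) < H := lt_of_lt_of_le hN (min_le_right _ _)
  obtain ⟨hx1, hxs0, hxs1⟩ := hxA
  have hxr : |x 0| ≤ r := hr x hx1 hxs0 hxs1
  have hrN' : (r : ℝ) ≤ N := by exact_mod_cast hrN
  have hN0 : (0 : ℝ) ≤ N := Nat.cast_nonneg N
  have hxB : x ∈ B := by
    have hx0 : |δ * x 0| < K := by
      rw [abs_mul, abs_of_pos hδ]
      have : |(x 0 : ℝ)| ≤ r := by rw [← Int.cast_abs]; exact_mod_cast hxr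
      have h1 : δ * |(x 0 : ℝ)| ≤ δ * N := mul_le_mul_of_nonneg_left (this.trans hrN') hδ.le
      linarith
    refine ⟨by rw [hx1], (abs_lt.1 hx0).1, (abs_lt.1 hx0).2, ?_⟩
    have h1 : δ * ((x 1 : ℝ) + 1) ≤ δ * (N + 1) :=
      mul_le_mul_of_nonneg_left (by rw [hx1]; push_cast; linarith) hδ.le
    linarith
  have hnot : ω ∉ openConnIn B x z := fun h => hF ⟨x, ⟨hx1, hxs0, hxs1⟩, z, hzC, h⟩
  obtain ⟨w, hwS, hwB, hw⟩ := exists_exit_of_not_openConnIn hxB hconn hnot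
  refine ⟨x, ?_, w, fun hwbox => hwB ?_, openConnIn_mono (subset_univ _) _ _ hw⟩
  · rw [mem_box]
    intro i
    fin_cases i
    · exact abs_le.1 hxr
    · simp [hx1]
  · rw [mem_box] at hwbox
    have h0 := hwbox 0
    have h1 := hwbox 1
    have hw1 : 0 ≤ w 1 := hwS
    have hw0 : |(w 0 : ℝ)| ≤ N := by rw [← Int.cast_abs]; exact_mod_cast abs_le.2 h0
    have hw1' : (w 1 : ℝ) ≤ N := by exact_mod_cast h1.2
    have hx0 : |δ * w 0| < K := by
      rw [abs_mul, abs_of_pos hδ]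
      have h1 : δ * |(w 0 : ℝ)| ≤ δ * N := mul_le_mul_of_nonneg_left hw0 hδ.le
      linarith
    refine ⟨hw1, (abs_lt.1 hx0).1, (abs_lt.1 hx0).2, ?_⟩
    have h1 : δ * ((w 1 : ℝ) + 1) ≤ δ * (N + 1) :=
      mul_le_mul_of_nonneg_left (by linarith) hδ.le
    linarith

/-- **UPPER bound, general mesh.** For a conformal rectangle `R` whose carrier is the box and whose
arcs `0`, `2` are `[S₀, S₁] × {0}`, `[S₂, S₃] × {0}` with `[Sᵢ, Sᵢ₊₁] ⊆ [-K + δ, K - δ]`, `2δ ≤ H`: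
`P_{1/2}[{S₀ ≤ δ v₀ ≤ S₁} ↔ {S₂ ≤ δ v₀ ≤ S₃} in ℤ × ℕ] ≤ bondDomainCrossingProb R δ +
P_{1/2}[Λ_r ↔ Λ_Nᶜ]` whenever the first arc lies in `Λ_r`, `r ≤ N`, `δ (N + 1) < min K H`.
[folklore] -/
theorem measureReal_openCrossing_halfPlane_le (hK : 0 < K) (hδ : 0 < δ) (hH2 : 2 * δ ≤ H)
    {S₀ S₁ S₂ S₃ : ℝ} (h0 : -K + δ ≤ S₀) (h1 : S₁ + δ ≤ K) (h2 : -K + δ ≤ S₂) (h3 : S₃ + δ ≤ K)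
    {r N : ℕ} (hr : ∀ v : Site 2, v 1 = 0 → S₀ ≤ δ * v 0 → δ * v 0 ≤ S₁ → |v 0| ≤ r)
    (hrN : r ≤ N) (hN : δ * (N + 1) < min K H) (R : ConformalRectangle)
    (hRc : R.carrier = Ioo (-K) K ×ℂ Ioo 0 H)
    (hR0 : R.arc 0 = {z : ℂ | z.im = 0 ∧ z.re ∈ Icc S₀ S₁})
    (hR2 : R.arc 2 = {z : ℂ | z.im = 0 ∧ z.re ∈ Icc S₂ S₃}) :
    μ.real (openCrossing halfPlane {v : Site 2 | v 1 = 0 ∧ S₀ ≤ δ * v 0 ∧ δ * v 0 ≤ S₁}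
        {v : Site 2 | v 1 = 0 ∧ S₂ ≤ δ * v 0 ∧ δ * v 0 ≤ S₃}) ≤
      bondDomainCrossingProb R δ +
        μ.real {ω | ∃ x ∈ box 2 r, ∃ y ∉ box 2 N, ω ∈ openConnIn univ x y} := by
  set A₀ : Set (Site 2) := {v : Site 2 | v 1 = 0 ∧ S₀ ≤ δ * v 0 ∧ δ * v 0 ≤ S₁}
  set A₂ : Set (Site 2) := {v : Site 2 | v 1 = 0 ∧ S₂ ≤ δ * v 0 ∧ δ * v 0 ≤ S₃}
  set B : Set (Site 2) :=
    {v : Site 2 | 0 ≤ v 1 ∧ -K < δ * v 0 ∧ δ * v 0 < K ∧ δ * (v 1 + 1) < H}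
  set E := openCrossing halfPlane A₀ A₂
  set F := openCrossing B A₀ A₂ with hF
  have hsplit : E ⊆ F ∪ (E \ F) := fun ω hω => by
    by_cases h : ω ∈ F
    · exact Or.inl h
    · exact Or.inr ⟨hω, h⟩
  have hF_le : μ.real F ≤ bondDomainCrossingProb R δ := by
    have hshift := real_openCrossing_shift (d := 2) half (![0, 1] : Site 2) B A₀ A₂
    rw [bondDomainCrossingProb_eq_measureReal, hRc, hR0, hR2, hF]
    change μ.real _ ≤ μ.real _
    change μ.real _ = μ.real _ at hshift
    rw [← hshift]
    refine ENNReal.toReal_mono (measure_ne_top _ _) (measure_mono_ae ?_)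
    filter_upwards [ae_subset_edgeSet] with ω hωE
    intro hω
    exact shift_openCrossing_subset hK hδ hH2 h0 h1 h2 h3 hωE hω
  have hdiff_le :
      μ.real (E \ F) ≤ μ.real {ω | ∃ x ∈ box 2 r, ∃ y ∉ box 2 N, ω ∈ openConnIn univ x y} :=
    measureReal_mono (diff_subset_escape hδ hr hrN hN) (measure_ne_top _ _)
  calc μ.real E ≤ μ.real (F ∪ (E \ F)) := measureReal_mono hsplit (measure_ne_top _ _)
    _ ≤ μ.real F + μ.real (E \ F) := measureReal_union_le _ _
    _ ≤ _ := add_le_add hF_le hdiff_le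

end MeshSandwich

/-- Registered stub `stub_meshLower` of line `Sketch`: the LOWER half of the general-mesh lattice
sandwich (`MeshSandwich.bondDomainCrossingProb_le`). [folklore] -/
theorem stub_meshLower :
    ∀ (K H δ S₀ S₁ S₂ S₃ : ℝ) (R : Literature.Probability.RandomPlanarGeometry.ConformalRectangle),
      0 < K → 0 < δ → 2 * δ < H → S₀ ≤ S₁ → S₂ ≤ S₃ → -K < S₀ - δ → S₁ + δ < K → -K < S₂ - δ →
      S₃ + δ < K → R.carrier = (Set.Ioo (-K) K ×ℂ Set.Ioo 0 H) →
      R.arc 0 = {z : ℂ | z.im = 0 ∧ z.re ∈ Set.Icc S₀ S₁} →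
      R.arc 2 = {z : ℂ | z.im = 0 ∧ z.re ∈ Set.Icc S₂ S₃} →
      Literature.Probability.Percolation.bondDomainCrossingProb R δ ≤
        μ.real (openCrossing halfPlane {v : Site 2 | v 1 = 0 ∧ S₀ ≤ δ * v 0 ∧ δ * v 0 ≤ S₁}
          {v : Site 2 | v 1 = 0 ∧ S₂ ≤ δ * v 0 ∧ δ * v 0 ≤ S₃}) :=
  fun _ _ _ _ _ _ _ R hK hδ hH2 h01 h23 h0 h1 h2 h3 hRc hR0 hR2 =>
    MeshSandwich.bondDomainCrossingProb_le hK hδ hH2 h01 h23 h0 h1 h2 h3 R hRc hR0 hR2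

/-- Registered stub `stub_meshUpper` of line `Sketch`: the UPPER half of the general-mesh lattice
sandwich (`MeshSandwich.measureReal_openCrossing_halfPlane_le`). [folklore] -/
theorem stub_meshUpper :
    ∀ (K H δ S₀ S₁ S₂ S₃ : ℝ) (R : Literature.Probability.RandomPlanarGeometry.ConformalRectangle)
      (r N : ℕ), 0 < K → 0 < δ → 2 * δ ≤ H → -K + δ ≤ S₀ → S₁ + δ ≤ K → -K + δ ≤ S₂ → S₃ + δ ≤ K →
      (∀ v : Site 2, v 1 = 0 → S₀ ≤ δ * v 0 → δ * v 0 ≤ S₁ → |v 0| ≤ r) → r ≤ N →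
      δ * (N + 1) < min K H → R.carrier = (Set.Ioo (-K) K ×ℂ Set.Ioo 0 H) →
      R.arc 0 = {z : ℂ | z.im = 0 ∧ z.re ∈ Set.Icc S₀ S₁} →
      R.arc 2 = {z : ℂ | z.im = 0 ∧ z.re ∈ Set.Icc S₂ S₃} →
      μ.real (openCrossing halfPlane {v : Site 2 | v 1 = 0 ∧ S₀ ≤ δ * v 0 ∧ δ * v 0 ≤ S₁}
          {v : Site 2 | v 1 = 0 ∧ S₂ ≤ δ * v 0 ∧ δ * v 0 ≤ S₃}) ≤
        Literature.Probability.Percolation.bondDomainCrossingProb R δ +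
          μ.real {ω | ∃ x ∈ Literature.Probability.LatticeModels.box 2 r,
            ∃ y ∉ Literature.Probability.LatticeModels.box 2 N, ω ∈ openConnIn Set.univ x y} :=
  fun _ _ _ _ _ _ _ R _ _ hK hδ hH2 h0 h1 h2 h3 hr hrN hN hRc hR0 hR2 =>
    MeshSandwich.measureReal_openCrossing_halfPlane_le hK hδ hH2 h0 h1 h2 h3 hr hrN hN R hRc hR0 hR2

end Summit.CriticalPhenomena.CardyFormulaZ2.Cruxes.HalfPlaneMarkDensityLaw.SketchLine

end
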